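import Mathlib
import Summits.QuantumFields.QCD.Theorems.WilsonQuarkChessboardBackgroundSchwarzGram

/-!
# Abstract reflection-positivity Schwarz inequality for block matrices (helper for `BackgroundSchwarz`)

The linear algebra of the Osterwalder–Seiler/Lüscher site-reflection positivity of `r = 1` Wilson
fermions, at the level of DETERMINANTS and for an ASYMMETRIC background.  After a reindexing, the
antiperiodic Wilson–Dirac matrix of a gauge field has the block form (rows and columns indexed by
`(ι ⊕ ι) ⊕ (β₁ ⊕ β₂)` = positive interior, reflected negative interior, and the two halves of the
spinor components on the two reflection hyperplanes)

`𝕄(P; Q) = [[A, 0, Aib, 0], [0, Sg A°ᴴ Sg, 0, Sg A°biᴴ], [0, -A°ibᴴ Sg, B₁, -A°bbᴴ], [Abi, 0, Abb, B₂]]`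

where `P = (A, Aib, Abi, Abb)` are the blocks built from the links of the positive half,
`Q = (A°, A°ib, A°bi, A°bb)` the same blocks built from the REFLECTED negative half, `Sg` (`Sg² = 1`)
the `γ₀`-sign, and `B₁, B₂ ≻ 0` the spatial Wilson operators on the two hyperplanes
(Montvay–Münster (4.104)–(4.105): the only coupling of the two halves, positive for `6κ < 1`).
Eliminating the interiors (Schur complements `S = Abb - Abi A⁻¹ Aib`) gives
`det 𝕄(P; Q) = det A · conj (det A°) · det B₁ · det (B₂ + S B₁⁻¹ S°ᴴ)`, and
`B₂ + S B₁⁻¹ S°ᴴ = Z_Sᴴ W Z_{S°}` is a Gram pairing with the positive weight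
`W = B₂ ⊕ B₁⁻¹`; the Gram–Cauchy–Schwarz inequality for determinants
(`normSq_det_conjTranspose_mul_le`) yields `‖det 𝕄(P;Q)‖² ≤ det 𝕄(P;P) · det 𝕄(Q;Q)` with both
factors real `≥ 0`.  This file proves the version with `A, A°` invertible; the general case follows
in the sequel by a mass perturbation.
-/

namespace Summit.QuantumFields.QCD.Theorems.BackgroundSchwarz

open Matrix
open scoped ComplexOrder MatrixOrder ComplexConjugate

variable {ι β₁ β₂ : Type*} [Fintype ι] [Fintype β₁] [Fintype β₂]
  [DecidableEq ι] [DecidableEq β₁] [DecidableEq β₂]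

section Inv

variable (Sg : Matrix ι ι ℂ) (B₁ : Matrix β₁ β₁ ℂ) (B₂ : Matrix β₂ β₂ ℂ)
  (A : Matrix ι ι ℂ) (Aib : Matrix ι β₁ ℂ) (Abi : Matrix β₂ ι ℂ) (Abb : Matrix β₂ β₁ ℂ)
  (A' : Matrix ι ι ℂ) (Aib' : Matrix ι β₁ ℂ) (Abi' : Matrix β₂ ι ℂ) (Abb' : Matrix β₂ β₁ ℂ)

/-- **Elimination of the interiors**: with `A, A°, B₁` invertible and `Sg² = 1`,
`det 𝕄(P; Q) = det A · conj (det A°) · (det B₁ · det (B₂ + S B₁⁻¹ S°ᴴ))` where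
`S = Abb - Abi A⁻¹ Aib`, `S° = A°bb - A°bi A°⁻¹ A°ib` are the boundary Schur complements. -/
theorem det_assemble (hSg : Sg * Sg = 1) (hA : IsUnit A.det) (hA' : IsUnit A'.det)
    (hB₁ : IsUnit B₁.det) :
    ((fromBlocks (fromBlocks A 0 0 (Sg * A'ᴴ * Sg)) (fromBlocks Aib 0 0 (Sg * Abi'ᴴ)) (fromBlocks 0 (-(Aib'ᴴ * Sg)) Abi 0) (fromBlocks B₁ (-Abb'ᴴ) Abb B₂))).det =
      A.det * star A'.det * (B₁.det *
        (B₂ + (Abb - Abi * A⁻¹ * Aib) * B₁⁻¹ * (Abb' - Abi' * A'⁻¹ * Aib')ᴴ).det) := by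
  have hdetSg : Sg.det * Sg.det = 1 := by rw [← det_mul, hSg, det_one]
  -- the reflected interior block and its inverse
  set N : Matrix ι ι ℂ := Sg * A'ᴴ * Sg with hN
  have hNdet : N.det = star A'.det := by
    rw [hN, det_mul, det_mul, det_conjTranspose, mul_comm (Sg.det), mul_assoc, hdetSg, mul_one]
  have hNu : IsUnit N.det := by
    rw [hNdet]; exact (isUnit_iff_ne_zero.2 (star_ne_zero.2 (isUnit_iff_ne_zero.1 hA')))
  have hNinv : N⁻¹ = Sg * (A'⁻¹)ᴴ * Sg := by
    refine inv_eq_left_inv ?_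
    rw [hN, conjTranspose_nonsing_inv]
    calc Sg * A'ᴴ⁻¹ * Sg * (Sg * A'ᴴ * Sg) = Sg * (A'ᴴ⁻¹ * (Sg * Sg) * A'ᴴ) * Sg := by
          simp only [Matrix.mul_assoc]
      _ = 1 := by
          rw [hSg, Matrix.mul_one, nonsing_inv_mul _ (by rw [det_conjTranspose]; exact hA'.star),
            Matrix.mul_one, hSg]
  letI : Invertible A := invertibleOfIsUnitDet A hA
  letI : Invertible N := invertibleOfIsUnitDet N hNu
  letI : Invertible B₁ := invertibleOfIsUnitDet B₁ hB₁
  letI : Invertible (fromBlocks A 0 0 N) := fromBlocksZero₂₁Invertible A 0 N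
  rw [det_fromBlocks₁₁, det_fromBlocks_zero₂₁, invOf_eq_nonsing_inv,
    inv_fromBlocks_zero₂₁_of_isUnit_iff _ _ _
      (iff_of_true ((isUnit_iff_isUnit_det A).2 hA) ((isUnit_iff_isUnit_det N).2 hNu))]
  have hGF : fromBlocks (0 : Matrix β₁ ι ℂ) (-((Aib')ᴴ * Sg)) Abi 0 *
      fromBlocks A⁻¹ (-(A⁻¹ * 0 * N⁻¹)) 0 N⁻¹ * fromBlocks Aib 0 0 (Sg * (Abi')ᴴ) =
      fromBlocks 0 (-((Abi' * A'⁻¹ * Aib')ᴴ)) (Abi * A⁻¹ * Aib) 0 := by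
    rw [Matrix.mul_zero, Matrix.zero_mul, neg_zero, fromBlocks_multiply, fromBlocks_multiply]
    simp only [Matrix.zero_mul, Matrix.mul_zero, zero_add, add_zero]
    congr 1
    rw [hNinv, conjTranspose_mul, conjTranspose_mul]
    simp only [Matrix.neg_mul, Matrix.mul_assoc]
    rw [← Matrix.mul_assoc Sg Sg, hSg, Matrix.one_mul, ← Matrix.mul_assoc Sg Sg, hSg, Matrix.one_mul]
  rw [hGF, sub_eq_add_neg, fromBlocks_neg, fromBlocks_add]
  simp only [neg_zero, add_zero, neg_neg]
  rw [det_fromBlocks₁₁, invOf_eq_nonsing_inv, hNdet]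
  congr 3
  rw [conjTranspose_sub, sub_eq_add_neg Abb]
  simp only [Matrix.mul_add, Matrix.mul_neg, Matrix.mul_sub, Matrix.add_mul, Matrix.neg_mul]
  abel

/-- **The Gram form of the boundary pairing**: `B₂ + S B₁⁻¹ S°ᴴ = Z_Sᴴ (B₂ ⊕ B₁⁻¹) Z_{S°}` with
`Z_S = [1; Sᴴ]`. -/
theorem pairing_eq_gram (S S' : Matrix β₂ β₁ ℂ) :
    B₂ + S * B₁⁻¹ * S'ᴴ =
      (fromRows (1 : Matrix β₂ β₂ ℂ) Sᴴ)ᴴ * fromBlocks B₂ 0 0 B₁⁻¹ * fromRows (1 : Matrix β₂ β₂ ℂ) S'ᴴ := by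
  rw [conjTranspose_fromRows_eq_fromCols_conjTranspose, conjTranspose_one,
    conjTranspose_conjTranspose, fromCols_mul_fromBlocks, fromCols_mul_fromRows]
  simp only [Matrix.mul_zero, Matrix.one_mul, add_zero, zero_add, Matrix.mul_one]

/-- **Abstract background Schwarz inequality, invertible interiors.**  For `Sg² = 1`, `B₁, B₂`
positive definite and `A, A°` invertible: `det 𝕄(P;P)` and `det 𝕄(Q;Q)` are real and non-negative
and `‖det 𝕄(P;Q)‖² ≤ det 𝕄(P;P) · det 𝕄(Q;Q)`. -/
theorem schwarz_assemble_of_isUnit (hSg : Sg * Sg = 1) (hB₁ : B₁.PosDef) (hB₂ : B₂.PosDef)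
    (hA : IsUnit A.det) (hA' : IsUnit A'.det) :
    (0 : ℂ) ≤ ((fromBlocks (fromBlocks A 0 0 (Sg * Aᴴ * Sg)) (fromBlocks Aib 0 0 (Sg * Abiᴴ)) (fromBlocks 0 (-(Aibᴴ * Sg)) Abi 0) (fromBlocks B₁ (-Abbᴴ) Abb B₂))).det ∧
    (0 : ℂ) ≤ ((fromBlocks (fromBlocks A' 0 0 (Sg * A'ᴴ * Sg)) (fromBlocks Aib' 0 0 (Sg * Abi'ᴴ)) (fromBlocks 0 (-(Aib'ᴴ * Sg)) Abi' 0) (fromBlocks B₁ (-Abb'ᴴ) Abb' B₂))).det ∧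
    ((‖((fromBlocks (fromBlocks A 0 0 (Sg * A'ᴴ * Sg)) (fromBlocks Aib 0 0 (Sg * Abi'ᴴ)) (fromBlocks 0 (-(Aib'ᴴ * Sg)) Abi 0) (fromBlocks B₁ (-Abb'ᴴ) Abb B₂))).det‖ ^ 2 : ℝ) : ℂ) ≤
      ((fromBlocks (fromBlocks A 0 0 (Sg * Aᴴ * Sg)) (fromBlocks Aib 0 0 (Sg * Abiᴴ)) (fromBlocks 0 (-(Aibᴴ * Sg)) Abi 0) (fromBlocks B₁ (-Abbᴴ) Abb B₂))).det *
        ((fromBlocks (fromBlocks A' 0 0 (Sg * A'ᴴ * Sg)) (fromBlocks Aib' 0 0 (Sg * Abi'ᴴ)) (fromBlocks 0 (-(Aib'ᴴ * Sg)) Abi' 0) (fromBlocks B₁ (-Abb'ᴴ) Abb' B₂))).det := by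
  have hB₁u : IsUnit B₁.det := isUnit_iff_ne_zero.2 hB₁.det_pos.ne'
  -- positive weight `W = B₂ ⊕ B₁⁻¹ = Eᴴ E`
  letI : Invertible B₂ := invertibleOfIsUnitDet B₂ (isUnit_iff_ne_zero.2 hB₂.det_pos.ne')
  have hW : (fromBlocks B₂ 0 0 B₁⁻¹).PosSemidef := by
    have h := (Matrix.PosDef.fromBlocks₁₁ (0 : Matrix β₂ β₁ ℂ) B₁⁻¹ hB₂).2
      (by simpa using hB₁.inv.posSemidef)
    simpa using h
  obtain ⟨E, hE⟩ := CStarAlgebra.nonneg_iff_eq_star_mul_self.mp hW.nonneg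
  have hgram : ∀ T T' : Matrix β₂ β₁ ℂ, B₂ + T * B₁⁻¹ * T'ᴴ =
      (E * fromRows (1 : Matrix β₂ β₂ ℂ) Tᴴ)ᴴ * (E * fromRows (1 : Matrix β₂ β₂ ℂ) T'ᴴ) := by
    intro T T'
    rw [pairing_eq_gram, hE, star_eq_conjTranspose, conjTranspose_mul]
    simp only [Matrix.mul_assoc]
  have hPQ := det_assemble Sg B₁ B₂ A Aib Abi Abb A' Aib' Abi' Abb' hSg hA hA' hB₁u
  have hPP := det_assemble Sg B₁ B₂ A Aib Abi Abb A Aib Abi Abb hSg hA hA hB₁u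
  have hQQ := det_assemble Sg B₁ B₂ A' Aib' Abi' Abb' A' Aib' Abi' Abb' hSg hA' hA' hB₁u
  rw [hgram] at hPQ hPP hQQ
  rw [hPQ, hPP, hQQ]
  set X := E * fromRows (1 : Matrix β₂ β₂ ℂ) (Abb - Abi * A⁻¹ * Aib)ᴴ with hX
  set X' := E * fromRows (1 : Matrix β₂ β₂ ℂ) (Abb' - Abi' * A'⁻¹ * Aib')ᴴ with hX'
  have hB : (0 : ℂ) ≤ B₁.det := hB₁.posSemidef.det_nonneg
  have hsq : ∀ z : ℂ, (0 : ℂ) ≤ z * star z := fun z => by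
    rw [Complex.star_def, Complex.mul_conj']; exact_mod_cast sq_nonneg ‖z‖
  have hsq' : ∀ z : ℂ, z * star z = ((‖z‖ ^ 2 : ℝ) : ℂ) := fun z => by
    rw [Complex.star_def, Complex.mul_conj']; push_cast; ring
  refine ⟨mul_nonneg (hsq _) (mul_nonneg hB (gram_det_nonneg X)),
    mul_nonneg (hsq _) (mul_nonneg hB (gram_det_nonneg X')), ?_⟩
  have hCS := normSq_det_conjTranspose_mul_le X X'
  have h1 : ((‖B₁.det‖ : ℝ) : ℂ) = B₁.det := by
    rw [Complex.le_def] at hB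
    obtain ⟨hre, him⟩ := hB
    rw [Complex.zero_im] at him
    rw [Complex.zero_re] at hre
    apply Complex.ext
    · rw [Complex.ofReal_re, Complex.norm_def, Complex.normSq_apply, ← him, mul_zero, add_zero,
        Real.sqrt_mul_self hre]
    · rw [Complex.ofReal_im, ← him]
  have key : ((‖A.det * star A'.det * (B₁.det * (Xᴴ * X').det)‖ ^ 2 : ℝ) : ℂ) =
      (A.det * star A.det) * (A'.det * star A'.det) * (B₁.det * B₁.det) *
        ((‖(Xᴴ * X').det‖ ^ 2 : ℝ) : ℂ) := by
    simp only [norm_mul, norm_star]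
    rw [hsq' A.det, hsq' A'.det]
    conv_rhs => rw [← h1]
    push_cast
    ring
  rw [key]
  calc (A.det * star A.det) * (A'.det * star A'.det) * (B₁.det * B₁.det) *
        ((‖(Xᴴ * X').det‖ ^ 2 : ℝ) : ℂ)
      ≤ (A.det * star A.det) * (A'.det * star A'.det) * (B₁.det * B₁.det) *
        ((Xᴴ * X).det * (X'ᴴ * X').det) :=
        mul_le_mul_of_nonneg_left hCS (mul_nonneg (mul_nonneg (hsq _) (hsq _)) (mul_nonneg hB hB))
    _ = _ := by ring

end Inv

end Summit.QuantumFields.QCD.Theorems.BackgroundSchwarz
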